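import Mathlib
import Literature.NumberTheory.Transcendental.PeriodsWave0
import HarnessLib

/-!
# Beukers' integrals for `ζ(3)` (Beukers 1979; Andrews–Askey–Roy 1999, §7.7)

NAMED FACTS (D-0014: `def … : Prop`, no `sorry`) recording, as printed, the lemmas of
F. Beukers' proof of the irrationality of `ζ(3)` — *A note on the irrationality of `ζ(2)` and
`ζ(3)`*, Bull. London Math. Soc. **11** (1979) 268–272 — in the exposition of Andrews–Askey–Roy,
*Special Functions* (1999), §7.7 "The irrationality of `ζ(3)`", Lemmas 7.7.3–7.7.5 and display
(7.7.3), pp. 391–393 ("We follow Beukers's exposition"); the same chain is printed in A. Baker,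
*A Comprehensive Course in Number Theory* (2012), §13.7.

* `Beukers.logKernelIntegral r s = ∫∫_{(0,1)²} -log(xy)/(1-xy) · xʳ yˢ dx dy`,
  `Beukers.legendreLogIntegral n` = the same kernel against `pₙ(x)pₙ(y)`, `pₙ` = Mathlib's
  `Polynomial.shiftedLegendre n`;
* `Beukers.tripleIntegral n = ∫∫∫_{(0,1)³} (x(1-x)y(1-y)w(1-w))ⁿ / (1-(1-xy)w)ⁿ⁺¹ dx dy dw`
  (Beukers' integral `I_n`; `I_0 = 2ζ(3)`, `I_1 = 2(5ζ(3) - 6)`);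
* facts: `Beukers.logKernelIntegral_diag` / `_offDiag` (AAR Lemma 7.7.3, both cases with the
  printed closed forms), `Beukers.legendreLogIntegral_eq_tripleIntegral` (AAR Lemma 7.7.4
  with (7.7.3): the double integral against `pₙ(x)pₙ(y)` equals `I_n`),
  `Beukers.exists_int_linearForm` (AAR Lemma 7.7.4: `= (Aₙ + Bₙ ζ(3)) dₙ⁻³` with `Aₙ, Bₙ ∈ ℤ`, `dₙ = lcm(1,…,n)` = Mathlib's `Nat.lcmUpto n`, and
  `≠ 0`), `Beukers.tripleIntegral_pos_lt` (AAR Lemma 7.7.5: `0 < I_n < 2(√2-1)^{4n} ζ(3)`),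
  `Beukers.tripleIntegral_zero` (`I_0 = 2ζ(3)`, last display of the proof of Lemma 7.7.5).

`ζ(3)` is `Literature.NumberTheory.Transcendental.zetaValue 3` of `PeriodsWave0.lean` (the tree's
`irrational_zeta_three`, `AperyIrrationality.lean`, goes through Apéry's tables instead; Beukers'
integrals were absent from the tree). Integrals are Lebesgue (Bochner) set integrals over the open
unit square / cube written inline as `{p : Fin k → ℝ | ∀ i, p i ∈ Ioo 0 1}` (`k = 2, 3`; the
literal shape of `KZ.unitCube k` of `KZUnfoldedStokes.lean` and of the route items, kept import-free
here), the shape used by the Kontsevich–Zagier calculus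
`Literature.NumberTheory.Transcendental.KZ.IntegralRep` (route GammaCornerAnomaly of summit
KontsevichZagierPeriods, items AperyBeukersOne/AperyBeukersAll, whose two sides these facts
evaluate); the printed iterated integrals `∫₀¹∫₀¹` agree with them by Tonelli (nonnegative
integrands: `-log(xy) ≥ 0` and `1 - xy > 0` on the open square).

Deliberately NOT here: the identification `I_n = 2(aₙ ζ(3) - bₙ)` with Apéry's explicit sequences
(`aₙ = Σ C(n,k)²C(n+k,k)²`, `bₙ`), which neither AAR nor Baker print; the prime-number-theory
bound `dₙ < 3ⁿ` and the irrationality conclusion (already `irrational_zeta_three`).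

## References
* [Beukers1979] F. Beukers, A note on the irrationality of `ζ(2)` and `ζ(3)`, Bull. London Math.
  Soc. 11 (1979) 268–272, doi:10.1112/blms/11.3.268 (primary source, not held at the time of
  writing; every statement below is cited through the page-verified [AndrewsAskeyRoy1999]).
* [AndrewsAskeyRoy1999] G. E. Andrews, R. Askey, R. Roy, Special Functions, CUP (1999), §7.7,
  Lemmas 7.7.3–7.7.5, (7.7.3), pp. 391–393.
* A. Baker, A Comprehensive Course in Number Theory, CUP (2012), §13.7, pp. 157–158.
-/

noncomputable section

open MeasureTheory Set Polynomial

namespace Literature.NumberTheory.Transcendental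

namespace Beukers

/-- Beukers' logarithmic kernel integral
`∫∫_{(0,1)²} -log(xy)/(1 - xy) · xʳ yˢ dx dy` (`r, s ∈ ℕ`), as a Lebesgue set integral over the
open unit square `{p | ∀ i, p i ∈ Ioo 0 1}` (`p 0 = x`, `p 1 = y`).
[cite: AndrewsAskeyRoy1999, §7.7 Lemma 7.7.3] -/
def logKernelIntegral (r s : ℕ) : ℝ :=
  ∫ p in {p : Fin 2 → ℝ | ∀ i, p i ∈ Ioo (0 : ℝ) 1},
    -Real.log (p 0 * p 1) / (1 - p 0 * p 1) * (p 0 ^ r * p 1 ^ s)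

/-- Beukers' double integral against the shifted Legendre polynomials
`∫∫_{(0,1)²} -log(xy)/(1 - xy) · pₙ(x) pₙ(y) dx dy`, with `pₙ(x) = (1/n!) dⁿ/dxⁿ (xⁿ(1-x)ⁿ)` =
Mathlib's `Polynomial.shiftedLegendre n` (`Polynomial.factorial_mul_shiftedLegendre_eq`).
[cite: AndrewsAskeyRoy1999, §7.7 Lemma 7.7.4] -/
def legendreLogIntegral (n : ℕ) : ℝ :=
  ∫ p in {p : Fin 2 → ℝ | ∀ i, p i ∈ Ioo (0 : ℝ) 1},
    -Real.log (p 0 * p 1) / (1 - p 0 * p 1) *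
      (aeval (p 0) (shiftedLegendre n) * aeval (p 1) (shiftedLegendre n))

/-- Beukers' triple integral
`I_n = ∫∫∫_{(0,1)³} (x(1-x)y(1-y)w(1-w))ⁿ / (1 - (1-xy)w)ⁿ⁺¹ dx dy dw` (display (7.7.3) of
Andrews–Askey–Roy; `p 0 = x`, `p 1 = y`, `p 2 = w`). [cite: AndrewsAskeyRoy1999, §7.7 (7.7.3)] -/
def tripleIntegral (n : ℕ) : ℝ :=
  ∫ p in {p : Fin 3 → ℝ | ∀ i, p i ∈ Ioo (0 : ℝ) 1},
    (p 0 * (1 - p 0) * p 1 * (1 - p 1) * p 2 * (1 - p 2)) ^ n /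
      (1 - (1 - p 0 * p 1) * p 2) ^ (n + 1)

/-- **Beukers' lemma, diagonal case** (Andrews–Askey–Roy, Lemma 7.7.3, first case; Beukers 1979):
for every nonnegative integer `r`,
`∫₀¹∫₀¹ -log(xy)/(1-xy) · xʳ yʳ dx dy = 2 (ζ(3) - ∑_{k=1}^{r} k⁻³)`
(the sum written as `∑_{k<r} (k+1)⁻³`). [cite: AndrewsAskeyRoy1999, Lemma 7.7.3] -/
def logKernelIntegral_diag : Prop :=
  ∀ r : ℕ, logKernelIntegral r r =
    2 * (zetaValue 3 - ∑ k ∈ Finset.range r, 1 / ((k : ℝ) + 1) ^ 3)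

/-- **Beukers' lemma, off-diagonal case** (Andrews–Askey–Roy, Lemma 7.7.3, second case, with the
closed form printed in its proof; Beukers 1979): for `r > s ≥ 0`,
`∫₀¹∫₀¹ -log(xy)/(1-xy) · xʳ yˢ dx dy = (1/(r-s)) · (1/(s+1)² + ⋯ + 1/r²)`,
"a rational number whose denominator divides `d_r³`, `d_r = lcm(1, 2, …, r)`".
[cite: AndrewsAskeyRoy1999, Lemma 7.7.3] -/
def logKernelIntegral_offDiag : Prop :=
  ∀ r s : ℕ, s < r → logKernelIntegral r s =
    (∑ k ∈ Finset.Ioc s r, 1 / (k : ℝ) ^ 2) / ((r : ℝ) - s)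

/-- **Beukers' integral identity** (Andrews–Askey–Roy, Lemma 7.7.4 with display (7.7.3); Beukers
1979): with `pₙ(x) = (1/n!) dⁿ/dxⁿ (xⁿ(1-x)ⁿ)` the shifted Legendre polynomial (Mathlib's
`Polynomial.shiftedLegendre n`, `factorial_mul_shiftedLegendre_eq`),
`∫₀¹∫₀¹ -log(xy)/(1-xy) · pₙ(x) pₙ(y) dx dy
  = ∫₀¹∫₀¹∫₀¹ (x(1-x)y(1-y)w(1-w))ⁿ/(1-(1-xy)w)ⁿ⁺¹ dx dy dw`
(printed chain: `-log(xy)/(1-xy) = ∫₀¹ dz/(1-(1-xy)z)`, `n` integrations by parts in `x`, the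
substitution `w = (1-z)/(1-(1-xy)z)`, `n` integrations by parts).
[cite: AndrewsAskeyRoy1999, Lemma 7.7.4 and (7.7.3)] -/
def legendreLogIntegral_eq_tripleIntegral : Prop :=
  ∀ n : ℕ, legendreLogIntegral n = tripleIntegral n

/-- **Beukers' arithmetic lemma** (Andrews–Askey–Roy, Lemma 7.7.4; Beukers 1979): there are
integers `Aₙ, Bₙ` with
`0 ≠ ∫₀¹∫₀¹ -log(xy)/(1-xy) · pₙ(x) pₙ(y) dx dy = (Aₙ + Bₙ ζ(3)) dₙ⁻³`, `dₙ = lcm(1, …, n)`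
(Mathlib's `Nat.lcmUpto n`). [cite: AndrewsAskeyRoy1999, Lemma 7.7.4] -/
def exists_int_linearForm : Prop :=
  ∀ n : ℕ, ∃ A B : ℤ,
    legendreLogIntegral n = ((A : ℝ) + B * zetaValue 3) / (Nat.lcmUpto n : ℝ) ^ 3 ∧
      legendreLogIntegral n ≠ 0

/-- **Beukers' bound** (Andrews–Askey–Roy, Lemma 7.7.5; Beukers 1979):
`0 < |Aₙ + Bₙ ζ(3)| dₙ⁻³ < 2 (√2 - 1)^{4n} ζ(3)`, i.e. for the triple integral (7.7.3) (to which
the linear form is equal, and which is positive): `0 < I_n < 2(√2-1)^{4n} ζ(3)`. Stated for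
`n ≥ 1` (for `n = 0` the printed strict bound degenerates to the equality `I_0 = 2ζ(3)`,
`tripleIntegral_zero`). [cite: AndrewsAskeyRoy1999, Lemma 7.7.5] -/
def tripleIntegral_pos_lt : Prop :=
  ∀ n : ℕ, 0 < n →
    0 < tripleIntegral n ∧ tripleIntegral n < 2 * (Real.sqrt 2 - 1) ^ (4 * n) * zetaValue 3

/-- **`I_0 = 2ζ(3)`** (Andrews–Askey–Roy, proof of Lemma 7.7.5, last display, with Lemma 7.7.3 at
`r = s = 0`): `∫₀¹∫₀¹∫₀¹ dx dy dw / (1 - (1-xy)w) = ∫₀¹∫₀¹ -log(xy)/(1-xy) dx dy = 2 ζ(3)`.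
[cite: AndrewsAskeyRoy1999, Lemma 7.7.5 (proof)] -/
def tripleIntegral_zero : Prop :=
  tripleIntegral 0 = 2 * zetaValue 3

end Beukers

end Literature.NumberTheory.Transcendental

end
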